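import Mathlib
import Summits.Ventures.PercRepro2.SwOutFrozenBaseGAntipode
import Summits.Ventures.PercRepro2.SwOutShadowMultiRootJunctions

/-!
# THE FROZEN BASE, III: THE HINGE, the frozen cube inequality on the general doubly typed side,
and the rigid inequality on a part and a class from frozen blocks (blind cell PercRepro2, night-4
g38, 2026-08-29; proofs/NIGHT4-G38.md §3–§4)

For a frozen base with routed decorations the four clusters behave along the cube exactly as in
g35: the blue cluster of a root is decreasing (it visits the frozen part), the red cluster of `l`
is decreasing and the blue one increasing — THE HINGE, `cluster_l_decoRealRR_anti` /
`cluster_blue_l_decoRealRR_mono` (g35's closure argument with the frozen part added to the closure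
set of the red paths from outside; a red edge at the upper point from a changing decoration goes to
`l`: its bystander edges are blue at the base, its arm edges blue while the unit is `true`).  Hence
the general doubly typed side `gTypedQ` pulls back to a lower set of the cube
(`decoRealRR_mem_gTypedQ_of_le`) and the rigid counting inequality holds on it over the block:
**`FrozenDecoG.card_decoCubeRR_le_g`** — the frozen analogue of g35's
`DecoBaseE.card_decoCubeRR_le_g`, by the weak cube principle (the half-flipped points of the
frontier are not excluded).

`FrozenBlocks` is the abstract shape of design 19's blocks on a part of the side (a key and a block
function; every side point of the part in its block; every typed point of a block in the part with
the same key — the census's c2 / c5 —; every block the cube of a `FrozenDecoG` with `h` a root and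
`X` outside `H`): the rigid inequality on the part (`rigidOK_g_of_frozenBlocks_part`, g34's block
decomposition) and on every class fibred by the escaping set (`rigidOK_g_of_junctions_frozen`,
g35's fibration verbatim).  The row: SwOutFrozenBaseGRow.
-/

namespace Summit.Ventures.PercRepro2

namespace LocRows

open Hull

universe u v

variable {V : Type u} {E : Type v}

open scoped Classical

variable {ends : E → Sym2 V}

section Hinge

variable {ι : Type*} {A Z : ι → Set V} {ζ : Config E} {R H : Set V} {l : V} {RR : Finset E}
  {Fz : Set V} (hd : FrozenDecoG ends ζ R H l A Z RR Fz)
include hd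

/-- A blue edge inside `R ∪ armsFalseC ω' ∪ Fz` is blue at every `ω ≤ ω'`. -/
lemma FrozenDecoG.decoRealRR_blue_of_within_false {ω ω' : Config (ι ⊕ ↥RR)} (hω : ω ≤ ω')
    {e : E} (he : e ∈ within ends (R ∪ armsFalseC A (armPart ω') ∪ Fz))
    (hblue : decoRealRR ends A Z RR ζ ω' e = false) : decoRealRR ends A Z RR ζ ω e = false := by
  by_cases hrr : e ∈ RR
  · have h1 := hd.base.decoRealRR_rr_edge (ω := ω') hrr
    have h2 := hd.base.decoRealRR_rr_edge (ω := ω) hrr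
    have hω'' : ω' (Sum.inr ⟨e, hrr⟩) = false := by
      by_contra h'; rw [Bool.not_eq_false] at h'; rw [h1.2 h'] at hblue; simp at hblue
    have hω₀ : ω (Sum.inr ⟨e, hrr⟩) = false := by
      have := hω (Sum.inr ⟨e, hrr⟩); rw [hω''] at this; exact Bool.eq_false_of_le_false this
    by_contra h'; rw [Bool.not_eq_false] at h'
    rw [h2.1 h'] at hω₀; simp at hω₀
  · rw [← hblue]
    refine hd.base.decoRealRR_eq_of_agree (fun i ⟨x, hx, hxe⟩ => ?_) (fun h' => absurd h' hrr)
    obtain ⟨a, ha, b, hb', hab⟩ := he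
    rw [hab, Sym2.mem_iff] at hxe
    have key : ∀ w, w ∈ R ∪ armsFalseC A (armPart ω') ∪ Fz → w ∈ unitAZ A Z i →
        armPart ω' i = false := by
      rintro w ((hw | ⟨j, hj, hw⟩) | hw) hwi
      · exact absurd hwi (hd.base.root_notMem_unit hw i)
      · rcases hwi with hwi | hwi
        · have hji : j = i := by
            by_contra hne
            exact hd.base.arm_disj j i hne w hw hwi
          rw [← hji]; exact hj
        · exact absurd hw (hd.base.deco_notMem_arm hwi)
      · exact absurd hwi (hd.base.fz_notMem_unit hw i)
    have hi' : armPart ω' i = false := by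
      rcases hxe with rfl | rfl
      · exact key x ha hx
      · exact key x hb' hx
    simp only [armPart] at hi'
    have hi : ω (Sum.inl i) = false := by
      have := hω (Sum.inl i); rw [hi'] at this; exact Bool.eq_false_of_le_false this
    rw [hi, hi']

/-- **The blue cluster of a root is decreasing in the cube point.** -/
theorem FrozenDecoG.cluster_blue_decoRealRR_anti {r : V} (hr : r ∈ R) {ω ω' : Config (ι ⊕ ↥RR)}
    (hω : ω ≤ ω') :
    cluster ends (blue (decoRealRR ends A Z RR ζ ω')) r ⊆
      cluster ends (blue (decoRealRR ends A Z RR ζ ω)) r :=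
  cluster_subset_of_le_within (S := R ∪ armsFalseC A (armPart ω') ∪ Fz)
    (fun _ hx _ hxy => hd.blue_closed ω' hx hxy) (Or.inl (Or.inl hr))
    (fun e he hblue => by
      rw [blue_eq_true_iff] at hblue ⊢
      exact hd.decoRealRR_blue_of_within_false hω he hblue)

/-! ### The hinge: the clusters of `l` -/

/-- An edge whose ends avoid the decorations of the changing units and lie outside `H`, in arms
that are `false` at `ω'`, or in the frozen part is coloured alike at `ω ≤ ω'`. -/
lemma FrozenDecoG.decoRealRR_eq_of_out_false {ω ω' : Config (ι ⊕ ↥RR)} (hω : ω ≤ ω') {e : E}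
    {x y : V} (hxy : ends e = s(x, y)) (hx : x ∈ Hᶜ ∪ armsFalseC A (armPart ω') ∪ Fz)
    (hy : y ∈ Hᶜ ∪ armsFalseC A (armPart ω') ∪ Fz)
    (hxD : ¬ ∃ i, DecoBaseE.changing ω ω' i ∧ x ∈ Z i)
    (hyD : ¬ ∃ i, DecoBaseE.changing ω ω' i ∧ y ∈ Z i) :
    decoRealRR ends A Z RR ζ ω e = decoRealRR ends A Z RR ζ ω' e := by
  have hrr : e ∉ RR := hd.base.notMem_rr_of_notMem_R hxy (hd.notMem_R_of_mem_out_false hx)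
  refine hd.base.decoRealRR_eq_of_agree (fun j ⟨z, hz, hze⟩ => ?_) (fun h' => absurd h' hrr)
  rw [hxy, Sym2.mem_iff] at hze
  have key : ∀ w, w ∈ Hᶜ ∪ armsFalseC A (armPart ω') ∪ Fz →
      (¬ ∃ i, DecoBaseE.changing ω ω' i ∧ w ∈ Z i) → w ∈ unitAZ A Z j →
        ω (Sum.inl j) = ω' (Sum.inl j) := by
    rintro w hw hwD (hwA | hwZ)
    · have hj' : armPart ω' j = false := by
        rcases hw with (hw | ⟨k, hk, hwk⟩) | hw
        · exact absurd (hd.base.arm_sub j w hwA).1 hw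
        · have hkj : k = j := by
            by_contra hne
            exact hd.base.arm_disj k j hne w hwk hwA
          rw [← hkj]; exact hk
        · exact absurd hw (hd.base.arm_sub j w hwA).2.2
      simp only [armPart] at hj'
      have hj : ω (Sum.inl j) = false := by
        have := hω (Sum.inl j); rw [hj'] at this; exact Bool.eq_false_of_le_false this
      rw [hj, hj']
    · exact DecoBaseE.coord_eq_of_not_changing hω (fun hc => hwD ⟨j, hc, hwZ⟩)
  rcases hze with rfl | rfl
  · exact key z hx hxD hz
  · exact key z hy hyD hz

/-- An edge whose ends avoid the decorations of the changing units and lie outside `H` or in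
arms that are `true` at `ω` is coloured alike at `ω ≤ ω'`. -/
lemma FrozenDecoG.decoRealRR_eq_of_out_true {ω ω' : Config (ι ⊕ ↥RR)} (hω : ω ≤ ω') {e : E}
    {x y : V} (hxy : ends e = s(x, y)) (hx : x ∈ Hᶜ ∪ armsTrueC A (armPart ω))
    (hy : y ∈ Hᶜ ∪ armsTrueC A (armPart ω))
    (hxD : ¬ ∃ i, DecoBaseE.changing ω ω' i ∧ x ∈ Z i)
    (hyD : ¬ ∃ i, DecoBaseE.changing ω ω' i ∧ y ∈ Z i) :
    decoRealRR ends A Z RR ζ ω e = decoRealRR ends A Z RR ζ ω' e := by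
  have hrr : e ∉ RR := hd.base.notMem_rr_of_notMem_R hxy (hd.notMem_R_of_mem_out_true hx)
  refine hd.base.decoRealRR_eq_of_agree (fun j ⟨z, hz, hze⟩ => ?_) (fun h' => absurd h' hrr)
  rw [hxy, Sym2.mem_iff] at hze
  have key : ∀ w, w ∈ Hᶜ ∪ armsTrueC A (armPart ω) →
      (¬ ∃ i, DecoBaseE.changing ω ω' i ∧ w ∈ Z i) → w ∈ unitAZ A Z j →
        ω (Sum.inl j) = ω' (Sum.inl j) := by
    rintro w hw hwD (hwA | hwZ)
    · have hj : armPart ω j = true := by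
        rcases hw with hw | ⟨k, hk, hwk⟩
        · exact absurd (hd.base.arm_sub j w hwA).1 hw
        · have hkj : k = j := by
            by_contra hne
            exact hd.base.arm_disj k j hne w hwk hwA
          rw [← hkj]; exact hk
      simp only [armPart] at hj
      have hj' : ω' (Sum.inl j) = true := by
        have := hω (Sum.inl j); rw [hj] at this; exact Bool.eq_true_of_true_le this
      rw [hj, hj']
    · exact DecoBaseE.coord_eq_of_not_changing hω (fun hc => hwD ⟨j, hc, hwZ⟩)
  rcases hze with rfl | rfl
  · exact key z hx hxD hz
  · exact key z hy hyD hz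

/-- **THE HINGE, RED: the red cluster of `l` is decreasing in the cube point.** -/
theorem FrozenDecoG.cluster_l_decoRealRR_anti {ω ω' : Config (ι ⊕ ↥RR)} (hω : ω ≤ ω') :
    cluster ends (decoRealRR ends A Z RR ζ ω') l ⊆ cluster ends (decoRealRR ends A Z RR ζ ω) l := by
  let Q : Set V := {x | (x ∈ Hᶜ ∪ armsFalseC A (armPart ω') ∪ Fz ∧
    x ∈ cluster ends (decoRealRR ends A Z RR ζ ω) l) ∨
    ∃ i, DecoBaseE.changing ω ω' i ∧ x ∈ Z i}
  have hQsub : Q ⊆ cluster ends (decoRealRR ends A Z RR ζ ω) l := by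
    rintro x (⟨-, hx⟩ | ⟨i, hi, hx⟩)
    · exact hx
    · exact hd.deco_mem_cluster_l_of_false hi.1 hx
  intro x hx
  refine hQsub (mem_of_conn_of_closed (ends := ends) (ω := decoRealRR ends A Z RR ζ ω') ?_
    (Or.inl ⟨Or.inl (Or.inl hd.base.l_notMem), mem_cluster_self _ _ _⟩) hx)
  intro x hx y hxy
  have hxS : x ∈ Hᶜ ∪ armsFalseC A (armPart ω') ∪ Fz := by
    rcases hx with ⟨hxS, -⟩ | ⟨i, -, hxi⟩
    · exact hxS
    · exact Or.inl (Or.inl (hd.base.deco_notMem i x hxi))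
  have hyS : y ∈ Hᶜ ∪ armsFalseC A (armPart ω') ∪ Fz := hd.red_closed_out ω' hxS hxy
  by_cases hyD : ∃ i, DecoBaseE.changing ω ω' i ∧ y ∈ Z i
  · exact Or.inr hyD
  refine Or.inl ⟨hyS, ?_⟩
  obtain ⟨_, e, he, hxy'⟩ := exists_edge_of_adj hxy
  by_cases hxD : ∃ i, DecoBaseE.changing ω ω' i ∧ x ∈ Z i
  · -- the edge leaves a decoration of a changing unit: it goes to `l`
    obtain ⟨i, hi, hxi⟩ := hxD
    rcases hd.deco_edges i e x y hxy' hxi with hyA | hyZ | rfl | ⟨-, -, hblue⟩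
    · exfalso
      have := (hd.base.decoRealRR_out_edge (ends_swap hxy') hyA (hd.base.deco_notMem i x hxi)).1 he
      rw [hi.2] at this; exact absurd this (by decide)
    · exact absurd ⟨i, hi, hyZ⟩ hyD
    · exact mem_cluster_self _ _ _
    · exfalso
      rw [hd.base.decoRealRR_apply_of_mem hxy' (Or.inr hxi), if_pos hi.2, hblue] at he
      exact absurd he (by decide)
  · have hxl : x ∈ cluster ends (decoRealRR ends A Z RR ζ ω) l := by
      rcases hx with ⟨-, hxl⟩ | ⟨i, hi, hxi⟩
      · exact hxl
      · exact absurd ⟨i, hi, hxi⟩ hxD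
    have hred : decoRealRR ends A Z RR ζ ω e = true := by
      rw [hd.decoRealRR_eq_of_out_false hω hxy' hxS hyS hxD hyD]; exact he
    exact mem_cluster_of_edge hxl hred hxy'

/-- **THE HINGE, BLUE: the blue cluster of `l` is increasing in the cube point.** -/
theorem FrozenDecoG.cluster_blue_l_decoRealRR_mono {ω ω' : Config (ι ⊕ ↥RR)} (hω : ω ≤ ω') :
    cluster ends (blue (decoRealRR ends A Z RR ζ ω)) l ⊆
      cluster ends (blue (decoRealRR ends A Z RR ζ ω')) l := by
  let Q : Set V := {x | (x ∈ Hᶜ ∪ armsTrueC A (armPart ω) ∧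
    x ∈ cluster ends (blue (decoRealRR ends A Z RR ζ ω')) l) ∨
    ∃ i, DecoBaseE.changing ω ω' i ∧ x ∈ Z i}
  have hQsub : Q ⊆ cluster ends (blue (decoRealRR ends A Z RR ζ ω')) l := by
    rintro x (⟨-, hx⟩ | ⟨i, hi, hx⟩)
    · exact hx
    · exact hd.deco_mem_cluster_blue_l_of_true hi.2 hx
  intro x hx
  refine hQsub (mem_of_conn_of_closed (ends := ends) (ω := blue (decoRealRR ends A Z RR ζ ω)) ?_
    (Or.inl ⟨Or.inl hd.base.l_notMem, mem_cluster_self _ _ _⟩) hx)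
  intro x hx y hxy
  have hxS : x ∈ Hᶜ ∪ armsTrueC A (armPart ω) := by
    rcases hx with ⟨hxS, -⟩ | ⟨i, -, hxi⟩
    · exact hxS
    · exact Or.inl (hd.base.deco_notMem i x hxi)
  have hyS : y ∈ Hᶜ ∪ armsTrueC A (armPart ω) := hd.blue_closed_out ω hxS hxy
  by_cases hyD : ∃ i, DecoBaseE.changing ω ω' i ∧ y ∈ Z i
  · exact Or.inr hyD
  refine Or.inl ⟨hyS, ?_⟩
  obtain ⟨_, e, he, hxy'⟩ := exists_edge_of_adj hxy
  rw [blue_eq_true_iff] at he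
  by_cases hxD : ∃ i, DecoBaseE.changing ω ω' i ∧ x ∈ Z i
  · -- the edge leaves a decoration of a changing unit: it goes to `l`
    obtain ⟨i, hi, hxi⟩ := hxD
    rcases hd.deco_edges i e x y hxy' hxi with hyA | hyZ | rfl | ⟨-, -, hblue⟩
    · exfalso
      have := hd.base.decoRealRR_out_edge (ω := ω) (ends_swap hxy') hyA (hd.base.deco_notMem i x hxi)
      rw [this.2 hi.1] at he; exact absurd he (by decide)
    · exact absurd ⟨i, hi, hyZ⟩ hyD
    · exact mem_cluster_self _ _ _
    · exfalso
      rw [hd.base.decoRealRR_apply_of_mem hxy' (Or.inr hxi), if_neg (by simp [hi.1]), hblue] at he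
      exact absurd he (by decide)
  · have hxl : x ∈ cluster ends (blue (decoRealRR ends A Z RR ζ ω')) l := by
      rcases hx with ⟨-, hxl⟩ | ⟨i, hi, hxi⟩
      · exact hxl
      · exact absurd ⟨i, hi, hxi⟩ hxD
    have hblue : blue (decoRealRR ends A Z RR ζ ω') e = true := by
      rw [blue_eq_true_iff, ← hd.decoRealRR_eq_of_out_true hω hxy' hxS hyS hxD hyD]; exact he
    exact mem_cluster_of_edge hxl hblue hxy'

/-! ### The side and the inequality -/

/-- **The general doubly typed side pulls back to a lower set of the frozen cube** (`X` outside
`H`). -/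
theorem FrozenDecoG.decoRealRR_mem_gTypedQ_of_le [Fintype E] [DecidableEq E]
    {h : V} {𝓤 𝓓 𝓓'' : Set (Set V)} {X : Set V} {𝓤' : Set (Set V)} (hh : h ∈ R)
    (h𝓤 : IsUpperSet 𝓤) (h𝓓 : IsLowerSet 𝓓) (h𝓓'' : IsLowerSet 𝓓'') (h𝓤' : IsUpperSet 𝓤')
    (hX : ∀ x ∈ X, x ∉ H) {ω ω' : Config (ι ⊕ ↥RR)} (hω : ω ≤ ω')
    (hQ : decoRealRR ends A Z RR ζ ω' ∈ gTypedQ ends l h 𝓤 𝓓 𝓓'' X 𝓤') :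
    decoRealRR ends A Z RR ζ ω ∈ gTypedQ ends l h 𝓤 𝓓 𝓓'' X 𝓤' := by
  rw [mem_gTypedQ] at hQ ⊢
  obtain ⟨-, hA, hB, hRh, -, hBh⟩ := hQ
  refine ⟨?_, h𝓤 (hd.cluster_l_decoRealRR_anti hω) hA,
    h𝓓 (hd.cluster_blue_l_decoRealRR_mono hω) hB,
    h𝓓'' (hd.base.cluster_decoRealRR_mono hh hω) hRh, ?_,
    h𝓤' (hd.cluster_blue_decoRealRR_anti hh hω) hBh⟩
  · rintro (hhl | hhl)
    · exact (hd.root_notMem_cluster_out ω hd.base.l_notMem hh).1 hhl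
    · exact (hd.root_notMem_cluster_out ω hd.base.l_notMem hh).2 hhl
  · intro x hx hxH
    exact hX x hx (hd.hull_subset ω hh hxH)

/-- **THE FROZEN CUBE INEQUALITY, GENERAL DOUBLY TYPED SIDE**: the rigid counting inequality on
`gTypedQ` over the block of a frozen base with routed decorations (`X` outside `H`). -/
theorem FrozenDecoG.card_decoCubeRR_le_g [Fintype E] [DecidableEq E] [Fintype ι]
    {h : V} {𝓤 𝓓 𝓓'' : Set (Set V)} {X : Set V} {𝓤' : Set (Set V)} (hh : h ∈ R)
    (h𝓤 : IsUpperSet 𝓤) (h𝓓 : IsLowerSet 𝓓) (h𝓓'' : IsLowerSet 𝓓'') (h𝓤' : IsUpperSet 𝓤')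
    (hX : ∀ x ∈ X, x ∉ H) {𝓔 : Set (Set E)} (h𝓔 : IsUpperSet 𝓔) :
    ((decoCubeRR ends A Z RR ζ).filter fun ζ' =>
        ζ' ∈ gTypedQ ends l h 𝓤 𝓓 𝓓'' X 𝓤' ∧ redEdges ends ζ' h ∈ 𝓔).card ≤
      ((decoCubeRR ends A Z RR ζ).filter fun ζ' =>
        ζ' ∈ gTypedQ ends l h 𝓤 𝓓 𝓓'' X 𝓤' ∧ blueEdges ends ζ' h ∈ 𝓔).card := by
  have key := hd.base.card_decoCubeRR_le_of_lowerSet hh (↑(gTypedQ ends l h 𝓤 𝓓 𝓓'' X 𝓤'))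
    (fun ω' ω hω hQ => hd.decoRealRR_mem_gTypedQ_of_le hh h𝓤 h𝓓 h𝓓'' h𝓤' hX hω hQ) h𝓔
  simpa only [Finset.mem_coe] using key


end Hinge

section Blocks

variable [Fintype E] [DecidableEq E] {U : Set V} {ξ : Config E} {l h : V}
  {𝓤 𝓓 𝓓'' : Set (Set V)} {X : Set V} {𝓤' : Set (Set V)}

/-- **The frozen block structure of a part `P` of the general doubly typed side**: a key and a
block function; every side point of the part lies in its block; every point of a block in the
typed side lies in the part with the same key; every block is the cube of a general frozen base
with routed decorations whose roots contain `h` and whose hull region avoids `X`. -/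
def FrozenBlocks (ends : E → Sym2 V) (l h : V) (𝓤 𝓓 𝓓'' : Set (Set V)) (X : Set V)
    (𝓤' : Set (Set V)) (U : Set V) (ξ : Config E) (P : Config E → Prop) : Prop :=
  ∃ (K : Type v) (key : Config E → K) (block : K → Finset (Config E)),
    (∀ ζ ∈ gOutSide ends l h 𝓤 𝓓 𝓓'' X 𝓤' U ξ, P ζ → ζ ∈ block (key ζ)) ∧
    (∀ ζ ∈ gOutSide ends l h 𝓤 𝓓 𝓓'' X 𝓤' U ξ, P ζ → ∀ ζ' ∈ block (key ζ),
      ζ' ∈ gTypedQ ends l h 𝓤 𝓓 𝓓'' X 𝓤' →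
        ζ' ∈ gOutSide ends l h 𝓤 𝓓 𝓓'' X 𝓤' U ξ ∧ P ζ' ∧ key ζ' = key ζ) ∧
    (∀ ζ ∈ gOutSide ends l h 𝓤 𝓓 𝓓'' X 𝓤' U ξ, P ζ →
      ∃ (ι : Type v) (_ : Fintype ι) (A Z : ι → Set V) (RR : Finset E) (ζ₀ : Config E)
        (R H Fz : Set V),
        FrozenDecoG ends ζ₀ R H l A Z RR Fz ∧ h ∈ R ∧ (∀ x ∈ X, x ∉ H) ∧
          block (key ζ) = decoCubeRR ends A Z RR ζ₀)

/-- **The rigid inequality on a part from frozen blocks**: g34's block decomposition of the part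
with the frozen cube inequality on every block. -/
theorem rigidOK_g_of_frozenBlocks_part (h𝓤 : IsUpperSet 𝓤) (h𝓓 : IsLowerSet 𝓓)
    (h𝓓'' : IsLowerSet 𝓓'') (h𝓤' : IsUpperSet 𝓤') {P : Config E → Prop}
    (hfb : FrozenBlocks ends l h 𝓤 𝓓 𝓓'' X 𝓤' U ξ P) {𝓔 : Set (Set E)} (h𝓔 : IsUpperSet 𝓔) :
    ((gOutSide ends l h 𝓤 𝓓 𝓓'' X 𝓤' U ξ).filter fun ζ => P ζ ∧ redEdges ends ζ h ∈ 𝓔).card ≤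
      ((gOutSide ends l h 𝓤 𝓓 𝓓'' X 𝓤' U ξ).filter fun ζ => P ζ ∧ blueEdges ends ζ h ∈ 𝓔).card := by
  obtain ⟨K, key, block, hmem, hblock, hcube⟩ := hfb
  refine rigidOK_g_of_blocks_part key block P hmem hblock ?_ h𝓔
  intro ζ hζ hP 𝓔' h𝓔'
  obtain ⟨ι, _, A, Z, RR, ζ₀, R, H, Fz, hd, hh, hX, hblk⟩ := hcube ζ hζ hP
  rw [hblk]
  exact hd.card_decoCubeRR_le_g hh h𝓤 h𝓓 h𝓓'' h𝓤' hX h𝓔'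

/-- **THE MULTI-JUNCTION CLASS FROM FROZEN BLOCKS**: the rigid counting inequality on the general
doubly typed side of every class of a region with the junctions `J` (as g35's
`rigidOK_g_of_junctions_deco`), the side fibred by the escaping set in either colour, under the
frozen block structure on every fibre. -/
theorem rigidOK_g_of_junctions_frozen (h𝓤 : IsUpperSet 𝓤) (h𝓓 : IsLowerSet 𝓓)
    (h𝓓'' : IsLowerSet 𝓓'') (h𝓤' : IsUpperSet 𝓤') {J : Finset V}
    (hfb : ∀ T ⊆ J, FrozenBlocks ends l h 𝓤 𝓓 𝓓'' X 𝓤' U ξ fun ζ =>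
      (∀ r ∈ insert h (↑(J \ T) : Set V), hull ends ζ r ⊆ U) ∧
        (∀ u ∈ (↑T : Set V), ¬ hull ends ζ u ⊆ U))
    {𝓔 : Set (Set E)} (h𝓔 : IsUpperSet 𝓔) :
    ((gOutSide ends l h 𝓤 𝓓 𝓓'' X 𝓤' U ξ).filter fun ζ => redEdges ends ζ h ∈ 𝓔).card ≤
      ((gOutSide ends l h 𝓤 𝓓 𝓓'' X 𝓤' U ξ).filter fun ζ => blueEdges ends ζ h ∈ 𝓔).card := by
  set C := gOutSide ends l h 𝓤 𝓓 𝓓'' X 𝓤' U ξ with hC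
  have hmap : ∀ (P' : Config E → Prop) [DecidablePred P'], ∀ ζ ∈ C.filter P',
      escSetE ends J U ζ ∈ J.powerset :=
    fun _ _ _ _ => Finset.mem_powerset.2 (Finset.filter_subset _ _)
  rw [Finset.card_eq_sum_card_fiberwise (hmap (fun ζ => redEdges ends ζ h ∈ 𝓔)),
    Finset.card_eq_sum_card_fiberwise (hmap (fun ζ => blueEdges ends ζ h ∈ 𝓔))]
  refine Finset.sum_le_sum fun T hT => ?_
  have hTJ : T ⊆ J := Finset.mem_powerset.1 hT
  have hfib : ∀ (P' : Config E → Prop) [DecidablePred P'],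
      (C.filter P').filter (fun ζ => escSetE ends J U ζ = T) =
        C.filter (fun ζ => ((∀ r ∈ insert h (↑(J \ T) : Set V), hull ends ζ r ⊆ U) ∧
          (∀ u ∈ (↑T : Set V), ¬ hull ends ζ u ⊆ U)) ∧ P' ζ) := by
    intro P' _
    ext ζ
    simp only [Finset.mem_filter]
    constructor
    · rintro ⟨⟨hζ, hP⟩, hesc⟩
      exact ⟨hζ, (mem_fibreE_iff hTJ hζ).1 hesc, hP⟩
    · rintro ⟨hζ, hpart, hP⟩
      exact ⟨⟨hζ, hP⟩, (mem_fibreE_iff hTJ hζ).2 hpart⟩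
  rw [hfib (fun ζ => redEdges ends ζ h ∈ 𝓔), hfib (fun ζ => blueEdges ends ζ h ∈ 𝓔)]
  have main := rigidOK_g_of_frozenBlocks_part h𝓤 h𝓓 h𝓓'' h𝓤' (hfb T hTJ) h𝓔
  rw [hC]; convert main using 3; rfl


end Blocks

end LocRows

end Summit.Ventures.PercRepro2
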